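import Literature.AlgebraicGeometry.Motives.IntegralModelRestrictScalarsPoints
import Literature.AlgebraicGeometry.Motives.IntegralModelReductionMapClopen
import Literature.AlgebraicGeometry.AbelianSchemes.AbelianSchemeEquivariantFibreTransport
import Literature.AlgebraicGeometry.AbelianSchemes.AbelianSchemeOverLevelBaseChange
import Literature.AlgebraicGeometry.AbelianSchemes.PolarizedAbelianSchemeWithLevel
import HarnessLib

/-!
# The generic point of a restricted ∕ localised integral model, read in the ORIGINAL model (Ω-SHEET-READING)

Topic `Literature/AlgebraicGeometry/Motives`; namespace `Literature.AlgebraicGeometry.Motives.IntegralModel`.  Theorems only (no `def`,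
no instance, no notation, no named fact, no `sorry`).  Cell `hodgecm-mathlib`, P6 «MOD programme», sub-desk P6a, GEN layer — organ
«Ω-SHEET-READING (iv)» (A-p18 (g28) census 2026-09-01, A-p03 (g29)); sequel of ★ INT-RES ∕ INT-RES-POINTS
(`IntegralModelRestrictScalars*`).  HC_CM is proved only modulo the printed citations until rung 0 closes; nothing here is about HC.

THE MATHEMATICS ([GortzWedhorn2020] Prop. 4.16, §(4.8); [Hartshorne1977] II Thm. 3.3; [SerreTate1968] §1; [MumfordFogartyKirwan1994] Ch. 7 §2
Def. 7.2).  Let `𝓜` be an integral model over `B` of an `L`-scheme `Z` (`𝓞 L ⊆ B ⊆ L`, e.g. `B = 𝓞 L[1∕N]`), let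
`𝓨 := (restrictScalarsOfIntermediate hinj 𝓜).localise w` be the model over `𝒪_{F,(w)}` of `Z` regarded over `F` obtained by VIEWING `𝓜` over
`𝓞 F` and localising at a prime `w` of `F`.  Three open immersions of generic fibres are in play:
`ιᵢ : Z → 𝓜.total` (`𝓜.genericIso⁻¹ ≫ pr₁`), `ι_η : Z → 𝓨.total` (`𝓨.genericIso′⁻¹ ≫ pr₁`) and the projection
`π : 𝓨.total = 𝓜.total ×_{𝓞 F} 𝒪_{F,(w)} → 𝓜.total`.  Since the generic isomorphism of the viewed ∕ localised model is BY CONSTRUCTION the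
pasting isomorphism followed by `𝓜.genericIso` (★ `restrictScalars_genericIso_hom_left_comp`, ★ `localiseAt_genericIso_hom_left_comp_fst`),
**`ι_η ≫ π = ιᵢ`** (§1–§3).  Consequences: (§4) for an `Ω`-point `x` of `Z ∕ F` (`Ω = F̄_w`) the point of `𝓜` OVER ITS SHEET attached to the
model point `𝓨.modelPointsEquiv⁻¹ x` (★ `pointAt`) has underlying morphism `x ≫ ιᵢ : Spec Ω → 𝓜.total` — «the point of the localised restricted
model at `x` IS `𝓜`'s own point at `x`»; (§5) for an abelian scheme `𝒜` over `𝓜.total` (the universal object of a fine moduli scheme over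
`B`), the double base change `(𝒜 ×_{𝓜} 𝓨) ×_{𝓨} Z` along `π` then `ι_η` IS the base change of `𝒜` along `ιᵢ` as group schemes
(★ `IsBaseChangeVia`, by ★ `baseChange_isBaseChangeVia` twice, ★ `IsBaseChangeVia.trans` and `ι_η ≫ π = ιᵢ`), so its fibre at `x` is
`𝒜_{x ≫ ιᵢ}` NATURALLY in `𝒜` (★ `IsBaseChangeVia.exists_fibreIso[_natural]`): the D1 fields `univ := 𝒜 ×_{𝓜} 𝓨` of a moduli datum read, at
the thickening point `ℓ_e y`, the moduli tuple of `𝓜` at `ℓ_e y ≫ ιᵢ`, compatibly with `ι(a)`, `λ` and every homomorphism.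

MAIN STATEMENTS.  §1 `restrictScalars_genericIso_inv_left_comp_fst` (any pushout square of rings); §2
`localiseAt_genericIso_inv_left_comp_fst_comp_fst` (any `A → R → K`); §3 **`localise_restrictScalarsOfIntermediate_genericIso'_inv_left_comp`**
(`ι_η ≫ π = ιᵢ`); §4 **`pointAt_modelPointsEquiv_symm_left`** (+ the thickening reading `pointAt_modelPointsEquiv_symm_thickeningLift_left_comp_fst`:
followed by `𝓜.total ×_B L → Z = X ⊗_F L → X` it is `y`); §5 **`isBaseChangeVia_baseChange_localise_restrictScalarsOfIntermediate`**,
`exists_fibreIso_baseChange_localise_restrictScalarsOfIntermediate`, `exists_fibreIso_natural_baseChange_localise_restrictScalarsOfIntermediate`.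

## References
* [GortzWedhorn2020] U. Görtz, T. Wedhorn, *Algebraic Geometry I* (2nd ed.), Prop. 4.16, §(4.7)–(4.8) (transitivity of fibre products; fibres).
* [Hartshorne1977] R. Hartshorne, *Algebraic Geometry*, II Thm. 3.3 (p. 87) (fibre products and their universal property).
* [SerreTate1968] J.-P. Serre, J. Tate, *Good reduction of abelian varieties*, Ann. of Math. 88 (1968), §1 (models, localisation).
* [MumfordFogartyKirwan1994] D. Mumford, J. Fogarty, F. Kirwan, *Geometric Invariant Theory* (3rd ed.), Ch. 7 §2 Def. 7.2 (p. 129) (the moduli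
  functor: base change of `(X, λ, σᵢ)`).
-/

set_option autoImplicit false

noncomputable section

set_option backward.isDefEq.respectTransparency false

open CategoryTheory CategoryTheory.Limits AlgebraicGeometry IsDedekindDomain IsDedekindDomain.HeightOneSpectrum
open scoped NumberField nonZeroDivisors
open Literature.NumberTheory.EllipticCurves (genericFibre specGenericPoint)
open Literature.NumberTheory.GaloisRepresentations (closureValuationSubring)
open Literature.AlgebraicGeometry.Motives.AbelianVariety (bcSpec)
open Literature.AlgebraicGeometry.AbelianSchemes Literature.AlgebraicGeometry.AbelianSchemes.AbelianSchemeOver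

namespace Literature.AlgebraicGeometry.Motives.IntegralModel

/-! ### §1 The square level: `ι_{restrictScalars 𝓜} = ιᵢ` on underlying schemes -/

section Square

variable {A K B L : Type} [CommRing A] [Field K] [Algebra A K] [CommRing B] [Field L] [Algebra B L]
  [Algebra A B] [Algebra K L] [Algebra A L] [IsScalarTower A B L] [IsScalarTower A K L] [Algebra.IsPushout A B K L]
  {Z : SchemeOver L}

/-- **The generic-fibre inclusion of the model VIEWED over `A` is that of `𝓜`**: `(restrictScalars 𝓜).genericIso⁻¹ ≫ pr₁ = 𝓜.genericIso⁻¹ ≫ pr₁`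
as morphisms `Z → 𝓜.total` (★ `restrictScalars_genericIso_hom_left_comp`, precomposed with the inverse).
[cite: GortzWedhorn2020, Prop. 4.16 and §(4.8)] [cite: Hartshorne1977, II Thm. 3.3 (p. 87)] -/
theorem restrictScalars_genericIso_inv_left_comp_fst (𝓜 : IntegralModel B L Z) :
    (restrictScalars (A := A) (K := K) 𝓜).genericIso.inv.left ≫
        pullback.fst (𝓜.total.hom ≫ Spec.map (CommRingCat.ofHom (algebraMap A B))) (Spec.map (CommRingCat.ofHom (algebraMap A K))) =
      𝓜.genericIso.inv.left ≫ pullback.fst 𝓜.total.hom (Spec.map (CommRingCat.ofHom (algebraMap B L))) := by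
  have hinv : (restrictScalars (A := A) (K := K) 𝓜).genericIso.inv.left ≫ (restrictScalars (A := A) (K := K) 𝓜).genericIso.hom.left = 𝟙 _ := by
    rw [← Over.comp_left, Iso.inv_hom_id, Over.id_left]
  rw [← restrictScalars_genericIso_hom_left_comp (A := A) (K := K) 𝓜, reassoc_of% hinv]

end Square

/-! ### §2 The localisation level: `ι_{𝒳 ⊗ R} ≫ pr_𝒳 = ι_𝒳` -/

section LocaliseAt

variable {A K : Type} [CommRing A] [Field K] [Algebra A K] {X : SchemeOver K}
  (R : Type) [CommRing R] [Algebra A R] [Algebra R K] [IsScalarTower A R K]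

/-- **The generic-fibre inclusion of `𝒳 ⊗_A R` followed by the projection to `𝒳` is the generic-fibre inclusion of `𝒳`**:
`(𝒳.localiseAt R).genericIso⁻¹ ≫ pr₁ ≫ pr_𝒳 = 𝒳.genericIso⁻¹ ≫ pr₁` (★ `localiseAt_genericIso_hom_left_comp_fst`, precomposed with the inverse).
[cite: GortzWedhorn2020, Prop. 4.16 and §(4.8)] [cite: SerreTate1968, §1] -/
theorem localiseAt_genericIso_inv_left_comp_fst_comp_fst (𝒳 : IntegralModel A K X) :
    (𝒳.localiseAt R).genericIso.inv.left ≫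
        pullback.fst (pullback.snd 𝒳.total.hom (Spec.map (CommRingCat.ofHom (algebraMap A R))))
            (Spec.map (CommRingCat.ofHom (algebraMap R K))) ≫
          pullback.fst 𝒳.total.hom (Spec.map (CommRingCat.ofHom (algebraMap A R))) =
      𝒳.genericIso.inv.left ≫ pullback.fst 𝒳.total.hom (Spec.map (CommRingCat.ofHom (algebraMap A K))) := by
  have hinv : (𝒳.localiseAt R).genericIso.inv.left ≫ (𝒳.localiseAt R).genericIso.hom.left = 𝟙 _ := by
    rw [← Over.comp_left, Iso.inv_hom_id, Over.id_left]
  rw [← localiseAt_genericIso_hom_left_comp_fst (R := R) 𝒳, reassoc_of% hinv]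

end LocaliseAt

/-! ### §3 `ι_η ≫ π = ιᵢ` for `𝓨 = (restrictScalarsOfIntermediate hinj 𝓜).localise w` -/

section NumberField

variable {F L : Type} [Field F] [NumberField F] [Field L] [NumberField L] [Algebra F L]
  {B : Type} [CommRing B] [Algebra (𝓞 L) B] [Algebra B L] [IsScalarTower (𝓞 L) B L]
  [Algebra (𝓞 F) B] [IsScalarTower (𝓞 F) B L]
  (hinj : Function.Injective (algebraMap B L)) {Z : SchemeOver L} (w : HeightOneSpectrum (𝓞 F))

/-- **`ι_η ≫ π = ιᵢ`.**  For `𝓨 := (restrictScalarsOfIntermediate hinj 𝓜).localise w`: the generic-fibre inclusion `Z → 𝓨.total`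
(`𝓨.genericIso′⁻¹ ≫ pr₁`) followed by the projection `π : 𝓨.total → 𝓜.total` is `𝓜`'s own generic-fibre inclusion `𝓜.genericIso⁻¹ ≫ pr₁ : Z → 𝓜.total`
(§2 then §1). [cite: GortzWedhorn2020, Prop. 4.16 and §(4.8)] [cite: SerreTate1968, §1] -/
theorem localise_restrictScalarsOfIntermediate_genericIso'_inv_left_comp (𝓜 : IntegralModel B L Z) :
    ((restrictScalarsOfIntermediate (F := F) hinj 𝓜).localise w).genericIso'.inv.left ≫
        pullback.fst ((restrictScalarsOfIntermediate (F := F) hinj 𝓜).localise w).total.hom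
            (specGenericPoint (valuationSubringAtPrime F w) F) ≫
          pullback.fst (restrictScalarsOfIntermediate (F := F) hinj 𝓜).total.hom
            (Spec.map (CommRingCat.ofHom (algebraMap (𝓞 F) (valuationSubringAtPrime F w)))) =
      𝓜.genericIso.inv.left ≫ pullback.fst 𝓜.total.hom (Spec.map (CommRingCat.ofHom (algebraMap B L))) := by
  haveI := isPushout_of_injective (F := F) hinj
  exact (localiseAt_genericIso_inv_left_comp_fst_comp_fst (valuationSubringAtPrime F w)
      (restrictScalarsOfIntermediate (F := F) hinj 𝓜)).trans
    (restrictScalars_genericIso_inv_left_comp_fst (A := 𝓞 F) (K := F) 𝓜)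

/-! ### §4 The point of `𝓜` over its sheet at a model point of `𝓨` is `𝓜`'s own point -/

/-- **Ω-SHEET-READING.**  For an `Ω = F̄_w`-point `x` of `Z ∕ F`, the point of `𝓜` over its sheet (★ `pointAt`) attached to the model point
`𝓨.modelPointsEquiv⁻¹ x` of `𝓨 := (restrictScalarsOfIntermediate hinj 𝓜).localise w` has underlying morphism `x ≫ 𝓜.genericIso⁻¹ ≫ pr₁ :
Spec Ω → 𝓜.total` (★ `pointAt_left`, ★ `modelPointsEquiv_symm_left`, §3). [cite: Hartshorne1977, II Thm. 3.3 (p. 87)] [cite: SerreTate1968, §1] -/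
theorem pointAt_modelPointsEquiv_symm_left (𝓜 : IntegralModel B L Z)
    (x : AlgPoints (SchemeOver.restrictScalars F Z) (AlgebraicClosure (w.adicCompletion F))) :
    (pointAt hinj w 𝓜 _ (((restrictScalarsOfIntermediate (F := F) hinj 𝓜).localise w).modelPointsEquiv.symm x)).left =
      x.left ≫ 𝓜.genericIso.inv.left ≫ pullback.fst 𝓜.total.hom (Spec.map (CommRingCat.ofHom (algebraMap B L))) := by
  rw [pointAt_left, modelPointsEquiv_symm_left, Category.assoc, Category.assoc,
    localise_restrictScalarsOfIntermediate_genericIso'_inv_left_comp]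

/-- **The thickening case**, `Z = X ⊗_F L` and `x = ℓ_e y` (★ `thickeningLift`; `(thickening F L).obj X = SchemeOver.restrictScalars F (X ⊗_F L)`
on the nose): the point of `𝓜` over its sheet at the model point of `ℓ_e y`, followed by `𝓜.total ×_B L → X ⊗_F L → X` (`𝓜`'s generic
isomorphism and the first projection), is `y` — the `X`-coordinate of the moduli point is the record point.
[cite: GortzWedhorn2020, §(4.8)–(4.9)] [cite: Hartshorne1977, II Thm. 3.3 (p. 87)] -/
theorem pointAt_modelPointsEquiv_symm_thickeningLift_left_comp (X : SchemeOver F) (𝓜 : IntegralModel B L ((baseChange F L).obj X))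
    (e : L →ₐ[F] AlgebraicClosure (w.adicCompletion F)) (y : AlgPoints X (AlgebraicClosure (w.adicCompletion F))) :
    (pointAt hinj w 𝓜 _ (((restrictScalarsOfIntermediate (F := F) hinj 𝓜).localise w).modelPointsEquiv.symm
        (thickeningLift e X y))).left =
      (thickeningLift e X y).left ≫ 𝓜.genericIso.inv.left ≫ pullback.fst 𝓜.total.hom (Spec.map (CommRingCat.ofHom (algebraMap B L))) :=
  pointAt_modelPointsEquiv_symm_left hinj w 𝓜 (thickeningLift e X y)

omit [NumberField L] [Algebra (𝓞 L) B] [IsScalarTower (𝓞 L) B L] [Algebra (𝓞 F) B] [IsScalarTower (𝓞 F) B L] in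
/-- … and followed further by `pr₁ : 𝓜.total ×_B L → 𝓜.total`'s partner `𝓜.genericIso : 𝓜.total ×_B L ≅ X ⊗_F L` and `X ⊗_F L → X` it returns the
record point: `x ≫ 𝓜.genericIso⁻¹ ≫ 𝓜.genericIso ≫ pr_X = y` for `x = ℓ_e y` (★ `thickeningLift_left_comp_fst`).
[cite: GortzWedhorn2020, §(4.8)–(4.9)] -/
theorem thickeningLift_left_comp_genericIso_inv_hom_fst (X : SchemeOver F) (𝓜 : IntegralModel B L ((baseChange F L).obj X))
    (e : L →ₐ[F] AlgebraicClosure (w.adicCompletion F)) (y : AlgPoints X (AlgebraicClosure (w.adicCompletion F))) :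
    ((thickeningLift e X y).left ≫ 𝓜.genericIso.inv.left) ≫ 𝓜.genericIso.hom.left ≫ pullback.fst X.hom (bcSpec F L) = y.left := by
  rw [Category.assoc, ← Over.comp_left_assoc, Iso.inv_hom_id, Over.id_left, Category.id_comp]
  exact thickeningLift_left_comp_fst e X y

/-! ### §5 Abelian schemes over `𝓜.total`: the double base change along `π` then `ι_η` is the base change along `ιᵢ` -/

/-- **`(𝒜 ×_{𝓜} 𝓨) ×_{𝓨} Z` IS `𝒜 ×_{𝓜} Z` as group schemes** (★ `IsBaseChangeVia` along `ιᵢ = 𝓜.genericIso⁻¹ ≫ pr₁`, with structure map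
`pr ≫ pr`): ★ `baseChange_isBaseChangeVia` twice, ★ `IsBaseChangeVia.trans`, and `ι_η ≫ π = ιᵢ` (§3).  Hence every ★ `IsBaseChangeVia` consequence
(fibre isomorphisms natural in homomorphisms, transport of sections ∕ level structures ∕ polarizations) applies to the D1 fields
`univ := 𝒜 ×_{𝓜} 𝓨` of a moduli datum at the witness `𝓜 := restrictScalarsOfIntermediate hinj 𝓜ᵢ`.
[cite: MumfordFogartyKirwan1994, Ch. 7 §2 Definition 7.2 (p. 129)] [cite: GortzWedhorn2020, Prop. 4.16 and §(4.8)] -/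
theorem isBaseChangeVia_baseChange_localise_restrictScalarsOfIntermediate (𝓜 : IntegralModel B L Z)
    (𝒜 : AbelianSchemeOver 𝓜.total.left) :
    ((𝒜.baseChange
        (pullback.fst (restrictScalarsOfIntermediate (F := F) hinj 𝓜).total.hom
          (Spec.map (CommRingCat.ofHom (algebraMap (𝓞 F) (valuationSubringAtPrime F w)))))).baseChange
        (((restrictScalarsOfIntermediate (F := F) hinj 𝓜).localise w).genericIso'.inv.left ≫
          pullback.fst ((restrictScalarsOfIntermediate (F := F) hinj 𝓜).localise w).total.hom
            (specGenericPoint (valuationSubringAtPrime F w) F))).IsBaseChangeVia 𝒜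
      (𝓜.genericIso.inv.left ≫ pullback.fst 𝓜.total.hom (Spec.map (CommRingCat.ofHom (algebraMap B L))))
      (pullback.fst _ _ ≫ pullback.fst _ _) :=
  localise_restrictScalarsOfIntermediate_genericIso'_inv_left_comp hinj w 𝓜 ▸
    ((AbelianSchemeOver.baseChange_isBaseChangeVia _ _).trans (AbelianSchemeOver.baseChange_isBaseChangeVia 𝒜 _))

/-- **The generic fibre tuple of `univ := 𝒜 ×_{𝓜} 𝓨` at `x` is `𝒜`'s fibre at `x ≫ ιᵢ`**: an isomorphism of abelian varieties over `Ω`,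
over the projection (★ `IsBaseChangeVia.exists_fibreIso`).  At `x = ℓ_e y` the left side is the `fibreΩOf` of the P6a moduli datum.
[cite: MumfordFogartyKirwan1994, Ch. 7 §2 Definition 7.2 (p. 129)] [cite: GortzWedhorn2020, Section (4.7) (pp. 107–108) and Prop. 4.16 (p. 101)] -/
theorem exists_fibreIso_baseChange_localise_restrictScalarsOfIntermediate (𝓜 : IntegralModel B L Z)
    (𝒜 : AbelianSchemeOver 𝓜.total.left) (x : AlgPoints (SchemeOver.restrictScalars F Z) (AlgebraicClosure (w.adicCompletion F))) :
    ∃ φ : (((𝒜.baseChange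
              (pullback.fst (restrictScalarsOfIntermediate (F := F) hinj 𝓜).total.hom
                (Spec.map (CommRingCat.ofHom (algebraMap (𝓞 F) (valuationSubringAtPrime F w)))))).baseChange
              (((restrictScalarsOfIntermediate (F := F) hinj 𝓜).localise w).genericIso'.inv.left ≫
                pullback.fst ((restrictScalarsOfIntermediate (F := F) hinj 𝓜).localise w).total.hom
                  (specGenericPoint (valuationSubringAtPrime F w) F))).fibre x.left).toAbelianVariety ≅
          (𝒜.fibre (x.left ≫ 𝓜.genericIso.inv.left ≫
            pullback.fst 𝓜.total.hom (Spec.map (CommRingCat.ofHom (algebraMap B L))))).toAbelianVariety,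
      AbelianVariety.Hom.toSchemeHom φ.hom ≫
          pullback.fst 𝒜.X.hom (x.left ≫ 𝓜.genericIso.inv.left ≫
            pullback.fst 𝓜.total.hom (Spec.map (CommRingCat.ofHom (algebraMap B L)))) =
        pullback.fst _ x.left ≫ (pullback.fst _ _ ≫ pullback.fst _ _) :=
  (isBaseChangeVia_baseChange_localise_restrictScalarsOfIntermediate hinj w 𝓜 𝒜).exists_fibreIso x.left

/-- **… NATURALLY in `𝒜`**: for two abelian schemes `𝒜`, `ℬ` over `𝓜.total` there are such fibre isomorphisms `φ_𝒜`, `φ_ℬ` intertwining the fibre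
homomorphisms of EVERY pair `f : univ_𝒜 → univ_ℬ`, `g : 𝒜 → ℬ` of homomorphisms with `f ≫ (pr ≫ pr) = (pr ≫ pr) ≫ g` — in particular of
`f := (g ×_{𝓜} 𝓨) ×_{𝓨} Z` (★ `baseChangeHom` twice, ★ `baseChangeHom_left_comp_fst`) for `g = ι(a)` or a polarization `λ : 𝒜 → 𝒜^∨`
(★ `IsBaseChangeVia.exists_fibreIso_natural`). [cite: MumfordFogartyKirwan1994, Ch. 7 §2 Definition 7.2 (p. 129)]
[cite: GortzWedhorn2020, Section (4.7) (pp. 107–108) and Prop. 4.16 (p. 101)] -/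
theorem exists_fibreIso_natural_baseChange_localise_restrictScalarsOfIntermediate (𝓜 : IntegralModel B L Z)
    (𝒜 ℬ : AbelianSchemeOver 𝓜.total.left) (x : AlgPoints (SchemeOver.restrictScalars F Z) (AlgebraicClosure (w.adicCompletion F))) :
    ∃ (φ : (((𝒜.baseChange
              (pullback.fst (restrictScalarsOfIntermediate (F := F) hinj 𝓜).total.hom
                (Spec.map (CommRingCat.ofHom (algebraMap (𝓞 F) (valuationSubringAtPrime F w)))))).baseChange
              (((restrictScalarsOfIntermediate (F := F) hinj 𝓜).localise w).genericIso'.inv.left ≫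
                pullback.fst ((restrictScalarsOfIntermediate (F := F) hinj 𝓜).localise w).total.hom
                  (specGenericPoint (valuationSubringAtPrime F w) F))).fibre x.left).toAbelianVariety ≅
          (𝒜.fibre (x.left ≫ 𝓜.genericIso.inv.left ≫
            pullback.fst 𝓜.total.hom (Spec.map (CommRingCat.ofHom (algebraMap B L))))).toAbelianVariety)
      (ψ : (((ℬ.baseChange
              (pullback.fst (restrictScalarsOfIntermediate (F := F) hinj 𝓜).total.hom
                (Spec.map (CommRingCat.ofHom (algebraMap (𝓞 F) (valuationSubringAtPrime F w)))))).baseChange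
              (((restrictScalarsOfIntermediate (F := F) hinj 𝓜).localise w).genericIso'.inv.left ≫
                pullback.fst ((restrictScalarsOfIntermediate (F := F) hinj 𝓜).localise w).total.hom
                  (specGenericPoint (valuationSubringAtPrime F w) F))).fibre x.left).toAbelianVariety ≅
          (ℬ.fibre (x.left ≫ 𝓜.genericIso.inv.left ≫
            pullback.fst 𝓜.total.hom (Spec.map (CommRingCat.ofHom (algebraMap B L))))).toAbelianVariety),
      AbelianVariety.Hom.toSchemeHom φ.hom ≫
            pullback.fst 𝒜.X.hom (x.left ≫ 𝓜.genericIso.inv.left ≫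
              pullback.fst 𝓜.total.hom (Spec.map (CommRingCat.ofHom (algebraMap B L)))) =
          pullback.fst _ x.left ≫ (pullback.fst _ _ ≫ pullback.fst _ _) ∧
        AbelianVariety.Hom.toSchemeHom ψ.hom ≫
            pullback.fst ℬ.X.hom (x.left ≫ 𝓜.genericIso.inv.left ≫
              pullback.fst 𝓜.total.hom (Spec.map (CommRingCat.ofHom (algebraMap B L)))) =
          pullback.fst _ x.left ≫ (pullback.fst _ _ ≫ pullback.fst _ _) ∧
        ∀ (f : ((𝒜.baseChange
                  (pullback.fst (restrictScalarsOfIntermediate (F := F) hinj 𝓜).total.hom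
                    (Spec.map (CommRingCat.ofHom (algebraMap (𝓞 F) (valuationSubringAtPrime F w)))))).baseChange
                  (((restrictScalarsOfIntermediate (F := F) hinj 𝓜).localise w).genericIso'.inv.left ≫
                    pullback.fst ((restrictScalarsOfIntermediate (F := F) hinj 𝓜).localise w).total.hom
                      (specGenericPoint (valuationSubringAtPrime F w) F))).X ⟶
               ((ℬ.baseChange
                  (pullback.fst (restrictScalarsOfIntermediate (F := F) hinj 𝓜).total.hom
                    (Spec.map (CommRingCat.ofHom (algebraMap (𝓞 F) (valuationSubringAtPrime F w)))))).baseChange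
                  (((restrictScalarsOfIntermediate (F := F) hinj 𝓜).localise w).genericIso'.inv.left ≫
                    pullback.fst ((restrictScalarsOfIntermediate (F := F) hinj 𝓜).localise w).total.hom
                      (specGenericPoint (valuationSubringAtPrime F w) F))).X) [IsMonHom f]
          (g : 𝒜.X ⟶ ℬ.X) [IsMonHom g],
          f.left ≫ (pullback.fst _ _ ≫ pullback.fst _ _) = (pullback.fst _ _ ≫ pullback.fst _ _) ≫ g.left →
            fibreHom f x.left ≫ ψ.hom =
              φ.hom ≫ fibreHom g (x.left ≫ 𝓜.genericIso.inv.left ≫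
                pullback.fst 𝓜.total.hom (Spec.map (CommRingCat.ofHom (algebraMap B L)))) :=
  (isBaseChangeVia_baseChange_localise_restrictScalarsOfIntermediate hinj w 𝓜 𝒜).exists_fibreIso_natural
    (isBaseChangeVia_baseChange_localise_restrictScalarsOfIntermediate hinj w 𝓜 ℬ) x.left

end NumberField

end Literature.AlgebraicGeometry.Motives.IntegralModel
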